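import Literature.NumberTheory.LFunctions.TwistedZeroFreeRegion
import HarnessLib

/-!
# The zero-free region for twisted `L`-functions, uniformly in the field (MV §11.1, abstract)

Topic `Literature/NumberTheory/LFunctions`, a variant of `TwistedZeroFreeRegion.lean`
(Montgomery–Vaughan, Theorem 11.3, run once for an abstract datum
`TwistedZFRData η A C_g c₁ K₀ C₂ pole Q Λ₀ Λ₁ Λ₂ F`). Everything in this file is PROVED.

**Purpose.** For the Chebotarev / class-group prime number theorems with effective dependence on
the field (Lagarias–Odlyzko; J. Thorner, A. Zaman, *A unified and improved Chebotarev density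
theorem*, ANT 13 (2019), Theorem 3.1) one needs the region `σ > 1 − c/log(d_K (|t| + 3)^{n_K})`
free of zeros of the Hecke `L`-functions `L(s, χ)` of `K`, with `c` ABSOLUTE — i.e. the conductor
parameter `Q` of `TwistedZeroFreeRegion.lean` must be allowed to absorb the discriminant `|d_K|`.
Two hypotheses of `TwistedZFRData` are then too strong:

* `re_LSeries₀_le : Re L(Λ₀, σ) ≤ 1/(σ − 1) + K₀` with `K₀` independent of `Q`: for `Λ₀ = Λ_K`
  the constant term of `−ζ_K'/ζ_K(σ)` at `σ = 1` is of size `log|d_K|` in general (Stark's lemma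
  gives `−ζ_K'/ζ_K(σ) ≤ 1/(σ−1) + ½ log|d_K| + O(n_K)`); here we assume only
  `Re L(Λ₀, σ) ≤ 1/(σ − 1) + K₀ (log Q + log 4)`;
* `lower : c₁(σ − 1) ≤ |F(s)|` for `1 < σ ≤ 2` with `c₁` independent of `Q`: uniformly in `K` one
  only has `|L(s, χ)| ≥ ζ_K(σ)^{-1} ≥ e^{−n_K/(σ−1)}`; here we assume only what MV Lemma 11.1 uses,
  `|F(1 + η/32 + it)| ≥ c₁ η/32` at the centres of the discs.

With these two changes (`UniformTwistedZFRData`) Montgomery–Vaughan's proof goes through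
VERBATIM: the term `3K₀` of Cases 1–3 becomes `3K₀(log Q + log 4) ≤ 3K₀ ℒ`,
`ℒ = log Q + log(|γ| + 4)`, which is where it was absorbed anyway. We obtain, with constants that
are explicit functions of `η, A, C_g, c₁, K₀, C₂` alone:

* `UniformTwistedZFRData.exists_package` — MV Lemma 11.1 for `F`;
* `re_LSeries₁_le_of_zero`, `re_LSeries₁_le`, `re_LSeries₁_real_le_of_pair` — MV (11.2), (11.3);
* `not_zero_of_re_eq_one`, `one_sub_re_ge_of_noPole` (Case 1), `one_sub_re_ge_of_pole_far`
  (Case 2), `one_sub_re_ge_of_pole_near` (Case 3);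
* `UniformTwistedZFRData.of_twistedZFRData` — every `TwistedZFRData` is a `UniformTwistedZFRData`
  (the present theorems contain those of `TwistedZeroFreeRegion.lean`);
* `UniformTwistedZFRData.zeroFree_of_le` — **MV Theorem 11.3, abstract uniform form**: every zero
  `ρ = β + iγ` of `F` with `β > 1 − c/(log Q + log(|γ| + 4))` has `γ = 0`, and there is none
  unless `pole = true`; `exists_zeroFree_const` — the same with `∃ c > 0` quantified BEFORE the
  data (uniformity in `Q`, hence in the field and the character).

The proofs are those of `TwistedZeroFreeRegion.lean` (same radii `η/4`, `η/16`, same case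
analysis), with the dozen lines touching `K₀` or `lower` adapted; the generic lemmas
(`TwistedZFR.one_le_ell`, `ClassicalZFRData.re_sum_div_ge`, `DirichletZFR.re_sum_div_ge_pair`,
Titchmarsh's Lemma α) are reused, not restated.

## References

* H. L. Montgomery, R. C. Vaughan, *Multiplicative Number Theory I. Classical Theory*, Cambridge
  Stud. Adv. Math. 97 (2007), §11.1, Theorem 11.3 (proof, pp. 275–277).
  [cite: MontgomeryVaughan2007, §11.1 Theorem 11.3]
* J. C. Lagarias, A. M. Odlyzko, *Effective versions of the Chebotarev density theorem*, in:
  Algebraic Number Fields (Durham 1975), Academic Press 1977, §8 (Lemma 8.1, zero-free region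
  uniform in the field). [cite: LagariasOdlyzko1977, Lemma 8.1]
* J. Thorner, A. Zaman, *A unified and improved Chebotarev density theorem*, Algebra & Number
  Theory 13 (2019), Theorem 3.1. [cite: ThornerZaman2019, Theorem 3.1]

## Mathlib / tree search

Tree: `TwistedZFRData` and its theorems (`TwistedZeroFreeRegion.lean`, constants `K₀`, `c₁`
absolute — not applicable uniformly in `d_K`, see above); `ClassicalZFRData` (one `L`-function with
pole); `DirichletZFR.*` (Dirichlet characters). Mathlib: nothing on zero-free regions beyond
non-vanishing on `σ = 1`.
-/

noncomputable section

open Complex Filter Topology Metric Set Finset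
open scoped ComplexConjugate

namespace Literature.NumberTheory.LFunctions

/-! ## The hypotheses -/

/-- **Hypotheses of the uniform zero-free-region argument for a twisted `L`-function** `F`
(model: `F = L(s, χ)` for a class group or Hecke character `χ` of a number field `K`, the
parameter `Q` now also absorbing the discriminant `|d_K|`; `Λ₀ = Λ_K`, `Λ₁ = χΛ_K`, `Λ₂ = χ²Λ_K`):
the datum `TwistedZFRData` of `TwistedZeroFreeRegion.lean` with two hypotheses WEAKENED —
`re_LSeries₀_le` allows the constant term of `Re L(Λ₀, σ) ≤ 1/(σ−1) + …` to be `K₀(log Q + log 4)`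
(for `Λ₀ = Λ_K` it is `≍ log|d_K|`, Stark's lemma), and `lower` asks for `|F| ≥ c₁η/32` only at
the disc centres `1 + η/32 + it` — which is all the proof of MV Theorem 11.3 uses. See the file
docstring. [cite: MontgomeryVaughan2007, §11.1 (Lemmas 11.1–11.2)] -/
structure UniformTwistedZFRData (η A Cg c₁ K₀ C₂ : ℝ) (pole : Bool) (Q : ℝ)
    (Λ₀ : ℕ → ℝ) (Λ₁ Λ₂ : ℕ → ℂ) (F : ℂ → ℂ) : Prop where
  eta_pos : 0 < η
  eta_le_one : η ≤ 1
  A_nonneg : 0 ≤ A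
  Cg_pos : 0 < Cg
  c₁_pos : 0 < c₁
  K₀_nonneg : 0 ≤ K₀
  C₂_nonneg : 0 ≤ C₂
  one_le_Q : 1 ≤ Q
  /-- `Λ₀ ≥ 0`. -/
  nonneg : ∀ n, 0 ≤ Λ₀ n
  /-- `∑ Λ₀(n) n^{-s}` converges absolutely for `σ > 1`. -/
  summable : ∀ s : ℂ, 1 < s.re → LSeriesSummable (fun n ↦ (Λ₀ n : ℂ)) s
  /-- `Re L(Λ₀, σ) ≤ 1/(σ − 1) + K₀ (log Q + log 4)` for `1 < σ ≤ 2` (the pole of `ζ_K`; the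
  constant term may grow like `log Q`, e.g. `Q = |d_K|`, Stark's lemma). -/
  re_LSeries₀_le : ∀ σ : ℝ, 1 < σ → σ ≤ 2 →
    (LSeries (fun n ↦ (Λ₀ n : ℂ)) σ).re ≤ 1 / (σ - 1) + K₀ * (Real.log Q + Real.log 4)
  /-- `|Λ₁| ≤ Λ₀`. -/
  norm_le₁ : ∀ n, ‖Λ₁ n‖ ≤ Λ₀ n
  /-- `|Λ₂| ≤ Λ₀`. -/
  norm_le₂ : ∀ n, ‖Λ₂ n‖ ≤ Λ₀ n
  /-- `3-4-1`: `3 Re L(Λ₀,σ) + 4 Re L(Λ₁,σ+it) + Re L(Λ₂,σ+2it) ≥ 0` for `σ > 1`. -/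
  three_four_one : ∀ σ : ℝ, 1 < σ → ∀ t : ℝ,
    0 ≤ 3 * (LSeries (fun n ↦ (Λ₀ n : ℂ)) σ).re + 4 * (LSeries Λ₁ (σ + t * I)).re +
      (LSeries Λ₂ (σ + 2 * t * I)).re
  /-- `F` is holomorphic on `σ > 1 − η`. -/
  differentiableOn : DifferentiableOn ℂ F {s : ℂ | 1 - η < s.re}
  /-- `F ≠ 0` on `σ > 1`. -/
  ne_zero : ∀ s : ℂ, 1 < s.re → F s ≠ 0
  /-- `F'/F = −L(Λ₁, ·)` on `σ > 1`. -/
  logDeriv_eq : ∀ s : ℂ, 1 < s.re → deriv F s / F s = -LSeries Λ₁ s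
  /-- Polynomial growth in `Q` and `t`: `|F(s)| ≤ C_g Q^A (|t|+4)^A` for `1 − η < σ ≤ 3`. -/
  growth : ∀ s : ℂ, 1 - η < s.re → s.re ≤ 3 → ‖F s‖ ≤ Cg * Q ^ A * (|s.im| + 4) ^ A
  /-- Lower bound at the disc centres: `c₁ η/32 ≤ |F(1 + η/32 + it)|` for all real `t` (all that
  MV Lemma 11.1 uses of a lower bound to the right of `σ = 1`). -/
  lower : ∀ t : ℝ, c₁ * (η / 32) ≤ ‖F (1 + η / 32 + t * I)‖
  /-- The companion bound for `Λ₂` (with the pole term iff `pole`). -/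
  re_LSeries₂_le : ∀ s : ℂ, 1 < s.re → s.re ≤ 2 →
    (LSeries Λ₂ s).re ≤ (if pole then (1 / (s - 1)).re else 0) +
      C₂ * (Real.log Q + Real.log (|s.im| + 4))
  /-- Reflection symmetry of the zeros in the `pole` (real-character) case. -/
  reflect : pole = true → ∀ ρ : ℂ, 1 - η < ρ.re → F ρ = 0 → F (conj ρ) = 0

namespace UniformTwistedZFRData

variable {η A Cg c₁ K₀ C₂ : ℝ} {pole : Bool} {Q : ℝ} {Λ₀ : ℕ → ℝ} {Λ₁ Λ₂ : ℕ → ℂ} {F : ℂ → ℂ}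

/-- `1 ≤ log Q + log 4` for `Q ≥ 1`. [folklore] -/
theorem log_add_log_four_ge {Q : ℝ} (hQ : 1 ≤ Q) : 1 ≤ Real.log Q + Real.log 4 := by
  have := TwistedZFR.one_le_ell hQ 0
  rwa [abs_zero, zero_add] at this

/-- `log Q + log 4 ≤ log Q + log(|t| + 4)`. [folklore] -/
theorem log_add_log_four_le (Q t : ℝ) :
    Real.log Q + Real.log 4 ≤ Real.log Q + Real.log (|t| + 4) := by
  have := TwistedZFR.ell_zero_le Q t
  rwa [abs_zero, zero_add] at this

/-- Local notation for the package constant `E(η, A, C_g, c₁) = 8(2A + |log(32C_g/(c₁η))| + 1)/(η/4)`. -/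
local notation3 "E[" η "," A "," Cg "," c₁ "]" =>
  (8 * (2 * (A : ℝ) + |Real.log ((Cg : ℝ) / ((c₁ : ℝ) * ((η : ℝ) / 32)))| + 1) / ((η : ℝ) / 4))

section Package

variable (h : UniformTwistedZFRData η A Cg c₁ K₀ C₂ pole Q Λ₀ Λ₁ Λ₂ F)
include h

/-- A zero of `F` in the half-plane has real part `≤ 1`. [folklore] -/
theorem re_le_one_of_zero {a : ℂ} (ha : F a = 0) : a.re ≤ 1 := by
  by_contra hcon
  exact h.ne_zero a (not_le.1 hcon) ha

/-- `0 ≤ E(η, A, C_g, c₁)`. [folklore] -/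
theorem packageConst_nonneg : 0 ≤ E[η, A, Cg, c₁] := by
  have := h.eta_pos
  have := h.A_nonneg
  positivity

/-- **Montgomery–Vaughan Lemma 11.1 for `F`** (Titchmarsh's Lemma α on the disc centred at
`c = 1 + η/32 + it`, radius `η/4`): the zeros of `F` in `|a − c| ≤ η/4` form a finite set `S` with
multiplicities `m ≥ 1`, and `F'/F(z) = ∑_{a ∈ S} m(a)/(z − a) + ψ(z)` on `|z − c| < η/4` (off the
zeros) with `|ψ(z)| ≤ E (log Q + log(|t| + 4))` for `|z − c| ≤ η/16`, `E = E(η, A, C_g, c₁)`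
independent of `Q`, `t` and the datum: `|F| ≤ C_g Q^A (|t|+5)^A` on `|z − c| ≤ η/2` and
`|F(c)| ≥ c₁η/32` give `log(M/|F(c)|) ≤ (2A + |log(32C_g/(c₁η))|)(log Q + log(|t|+4))`.
[cite: MontgomeryVaughan2007, Lemma 11.1] -/
theorem exists_package (t : ℝ) :
    ∃ (S : Finset ℂ) (m : ℂ → ℕ) (ψ : ℂ → ℂ),
      (∀ a ∈ S, F a = 0 ∧ 0 < m a ∧ ‖a - (1 + η / 32 + t * I)‖ ≤ η / 4) ∧
      (∀ a, F a = 0 → ‖a - (1 + η / 32 + t * I)‖ ≤ η / 4 → a ∈ S) ∧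
      (∀ z ∈ ball (1 + η / 32 + t * I) (η / 4), F z ≠ 0 →
        ψ z = deriv F z / F z - ∑ a ∈ S, (m a : ℂ) / (z - a)) ∧
      (∀ z ∈ closedBall (1 + η / 32 + t * I) (η / 16),
        ‖ψ z‖ ≤ E[η, A, Cg, c₁] * (Real.log Q + Real.log (|t| + 4))) := by
  have hη := h.eta_pos
  have hη1 := h.eta_le_one
  have hA := h.A_nonneg
  have hCg := h.Cg_pos
  have hc₁ := h.c₁_pos
  have hQ := h.one_le_Q
  set R : ℝ := η / 4 with hR
  have hRpos : 0 < R := by positivity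
  set g₀ : ℝ := c₁ * (η / 32) with hg₀
  have hg₀pos : 0 < g₀ := by positivity
  set c : ℂ := 1 + η / 32 + t * I with hc
  have hcre : c.re = 1 + η / 32 := by simp [hc]
  have hcim : c.im = t := by simp [hc]
  -- lower bound at the centre
  have hcentre : g₀ ≤ ‖F c‖ := h.lower t
  have hFc : F c ≠ 0 := norm_pos_iff.1 (hg₀pos.trans_le hcentre)
  -- holomorphy on `ball c η`
  have hdiff : DifferentiableOn ℂ F (ball c η) := by
    refine h.differentiableOn.mono fun z hz ↦ ?_
    simp only [Set.mem_setOf_eq]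
    have h1 : |(z - c).re| ≤ ‖z - c‖ := abs_re_le_norm _
    rw [mem_ball_iff_norm] at hz
    rw [Complex.sub_re, hcre] at h1
    have := neg_abs_le (z.re - (1 + η / 32))
    linarith
  -- the bound `M` on `|z - c| ≤ 2R = η/2`
  set M : ℝ := Cg * Q ^ A * (|t| + 5) ^ A with hM
  have hQA : 1 ≤ Q ^ A := Real.one_le_rpow hQ hA
  have hMpos : 0 < M := by positivity
  have hMbound : ∀ z ∈ closedBall c (2 * R), ‖F z‖ ≤ M := by
    intro z hz
    rw [mem_closedBall_iff_norm] at hz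
    have h1 : |(z - c).re| ≤ ‖z - c‖ := abs_re_le_norm _
    have h2 : |(z - c).im| ≤ ‖z - c‖ := abs_im_le_norm _
    rw [Complex.sub_re, hcre] at h1
    rw [Complex.sub_im, hcim] at h2
    have hre1 : 1 - η < z.re := by
      have := neg_abs_le (z.re - (1 + η / 32)); rw [hR] at hz; linarith
    have hre2 : z.re ≤ 3 := by
      have := le_abs_self (z.re - (1 + η / 32)); rw [hR] at hz; linarith
    refine (h.growth z hre1 hre2).trans ?_
    rw [hM]
    have him : |z.im| + 4 ≤ |t| + 5 := by
      have := abs_sub_abs_le_abs_sub z.im t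
      rw [hR] at hz; linarith
    exact mul_le_mul_of_nonneg_left (Real.rpow_le_rpow (by positivity) him hA) (by positivity)
  obtain ⟨S, m, ψ, hS, hS', -, hψ, hψb, -⟩ :=
    Literature.Analysis.Complex.titchmarsh_logDeriv_sub_sum_of_differentiableOn hdiff
      (by rw [hR]; linarith) hFc hRpos hMbound
  refine ⟨S, m, ψ, ?_, ?_, ?_, fun z hz ↦ ?_⟩
  · simpa only [hR] using hS
  · simpa only [hR] using hS'
  · simpa only [hR] using hψ
  have hz' : z ∈ closedBall c (R / 4) := by rw [hR]; convert hz using 2; ring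
  refine (hψb z hz').trans ?_
  -- `log(M/‖F c‖) ≤ (2A + B)(log Q + log(|t| + 4))`, `B = |log(Cg/g₀)|`
  set B : ℝ := |Real.log (Cg / g₀)| with hB
  set ℒ : ℝ := Real.log Q + Real.log (|t| + 4) with hℒ
  have hℒ1 : 1 ≤ ℒ := TwistedZFR.one_le_ell hQ t
  have hlogQ : 0 ≤ Real.log Q := Real.log_nonneg hQ
  have hτ := ClassicalZFRData.one_le_log_tau t
  have hlogM : Real.log (M / ‖F c‖) ≤ (2 * A + B) * ℒ := by
    have hGc : 0 < ‖F c‖ := hg₀pos.trans_le hcentre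
    have hMle : M / ‖F c‖ ≤ Q ^ A * (|t| + 5) ^ A * (Cg / g₀) := by
      rw [hM, div_le_iff₀ hGc]
      calc Cg * Q ^ A * (|t| + 5) ^ A = Q ^ A * (|t| + 5) ^ A * (Cg / g₀) * g₀ := by field_simp
        _ ≤ Q ^ A * (|t| + 5) ^ A * (Cg / g₀) * ‖F c‖ := by gcongr
    have hMpos' : 0 < M / ‖F c‖ := div_pos hMpos hGc
    calc Real.log (M / ‖F c‖) ≤ Real.log (Q ^ A * (|t| + 5) ^ A * (Cg / g₀)) :=
          Real.log_le_log hMpos' hMle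
      _ = A * Real.log Q + A * Real.log (|t| + 5) + Real.log (Cg / g₀) := by
          rw [Real.log_mul (by positivity) (by positivity), Real.log_mul (by positivity) (by positivity),
            Real.log_rpow (by linarith), Real.log_rpow (by positivity)]
      _ ≤ A * Real.log Q + A * (2 * Real.log (|t| + 4)) + B * 1 := by
          gcongr
          · calc Real.log (|t| + 5) ≤ Real.log (2 * (|t| + 4)) :=
                  Real.log_le_log (by positivity) (by linarith [abs_nonneg t])
              _ ≤ 2 * Real.log (|t| + 4) := ClassicalZFRData.log_two_mul_tau_le t
          · rw [mul_one]; exact le_abs_self _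
      _ ≤ (2 * A + B) * ℒ := by
          rw [hℒ]
          have hB0 : 0 ≤ B := abs_nonneg _
          nlinarith
  have hfinal : 8 * (Real.log (M / ‖F c‖) + 1) / R ≤ 8 * (2 * A + B + 1) / R * ℒ := by
    calc 8 * (Real.log (M / ‖F c‖) + 1) / R ≤ 8 * ((2 * A + B) * ℒ + 1 * ℒ) / R := by
          gcongr; simpa using hℒ1
      _ = 8 * (2 * A + B + 1) / R * ℒ := by ring
  convert hfinal using 2

end Package

/-! ## The basic inequalities (MV (11.2), (11.3)) -/

section Inequalities

variable (h : UniformTwistedZFRData η A Cg c₁ K₀ C₂ pole Q Λ₀ Λ₁ Λ₂ F)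
include h

/-- First inequality of MV (11.2): `Re L(Λ₀, 1 + δ) ≤ 1/δ + K₀(log Q + log 4)` for `0 < δ ≤ 1`.
[cite: MontgomeryVaughan2007, Theorem 11.3 (proof, eq. (11.2))] -/
theorem re_LSeries₀_le_of_pos {d : ℝ} (hd : 0 < d) (hd1 : d ≤ 1) :
    (LSeries (fun n ↦ (Λ₀ n : ℂ)) ((1 + d : ℝ) : ℂ)).re ≤
      1 / d + K₀ * (Real.log Q + Real.log 4) := by
  have := h.re_LSeries₀_le (1 + d) (by linarith) (by linarith)
  rwa [show (1 + d : ℝ) - 1 = d by ring] at this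

/-- The companion bound with the pole term always allowed:
`Re L(Λ₂, s) ≤ Re 1/(s−1) + C₂(log Q + log(|t|+4))` for `1 < σ ≤ 2` (if `pole = false` the
hypothesis is stronger, `Re 1/(s − 1) ≥ 0`). [folklore] -/
theorem re_LSeries₂_le_pole (s : ℂ) (hs : 1 < s.re) (hs2 : s.re ≤ 2) :
    (LSeries Λ₂ s).re ≤ (1 / (s - 1)).re + C₂ * (Real.log Q + Real.log (|s.im| + 4)) := by
  have h1 := h.re_LSeries₂_le s hs hs2
  have hpos : 0 ≤ (1 / (s - 1)).re := by
    rw [one_div, Complex.inv_re]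
    exact div_nonneg (by simp; linarith) (Complex.normSq_nonneg _)
  cases pole
  · simp only [Bool.false_eq_true, ↓reduceIte, zero_add] at h1; linarith
  · simpa using h1

/-- The companion bound without pole (`pole = false`):
`Re L(Λ₂, s) ≤ C₂(log Q + log(|t|+4))` for `1 < σ ≤ 2`. [folklore] -/
theorem re_LSeries₂_le_noPole (hpole : pole = false) (s : ℂ) (hs : 1 < s.re) (hs2 : s.re ≤ 2) :
    (LSeries Λ₂ s).re ≤ C₂ * (Real.log Q + Real.log (|s.im| + 4)) := by
  have h1 := h.re_LSeries₂_le s hs hs2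
  subst hpole
  simpa using h1

/-- Second inequality of MV (11.2): if `β + iγ` is a zero of `F` with `β ≥ 1 − 7η/32`, then for
`0 < δ ≤ 3η/32`, `Re L(Λ₁, 1 + δ + iγ) = −Re F'/F(1+δ+iγ) ≤ E(log Q + log(|γ|+4)) − 1/(1 + δ − β)`
(package at height `γ`: every `Re 1/(s₀ − a)` is non-negative and the zero itself contributes
`1/(1 + δ − β)`). [cite: MontgomeryVaughan2007, Theorem 11.3 (proof, eq. (11.2))] -/
theorem re_LSeries₁_le_of_zero {E : ℝ}
    (hpack : ∀ t : ℝ, ∃ (S : Finset ℂ) (m : ℂ → ℕ) (ψ : ℂ → ℂ),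
      (∀ a ∈ S, F a = 0 ∧ 0 < m a ∧ ‖a - (1 + η / 32 + t * I)‖ ≤ η / 4) ∧
      (∀ a, F a = 0 → ‖a - (1 + η / 32 + t * I)‖ ≤ η / 4 → a ∈ S) ∧
      (∀ z ∈ ball (1 + η / 32 + t * I) (η / 4), F z ≠ 0 →
        ψ z = deriv F z / F z - ∑ a ∈ S, (m a : ℂ) / (z - a)) ∧
      (∀ z ∈ closedBall (1 + η / 32 + t * I) (η / 16),
        ‖ψ z‖ ≤ E * (Real.log Q + Real.log (|t| + 4))))
    {β γ d : ℝ} (hzero : F (β + γ * I) = 0) (hβ : 1 - 7 * η / 32 ≤ β) (hd : 0 < d)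
    (hd1 : d ≤ 3 * η / 32) :
    (LSeries Λ₁ (((1 + d : ℝ) : ℂ) + γ * I)).re ≤
      E * (Real.log Q + Real.log (|γ| + 4)) - 1 / (1 + d - β) := by
  have hη := h.eta_pos
  obtain ⟨S, m, ψ, hS, hS', hψ, hψb⟩ := hpack γ
  set s₀ : ℂ := ((1 + d : ℝ) : ℂ) + γ * I with hs₀
  have hs₀re : s₀.re = 1 + d := by simp [hs₀]
  have hs₀1 : 1 < s₀.re := by rw [hs₀re]; linarith
  have hβ1 : β ≤ 1 := by
    have := h.re_le_one_of_zero hzero; simpa using this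
  set c : ℂ := 1 + η / 32 + γ * I with hcdef
  have hs₀c : ‖s₀ - c‖ ≤ η / 16 := by
    have : s₀ - c = ((d - η / 32 : ℝ) : ℂ) := by simp only [hs₀, hcdef]; push_cast; ring
    rw [this, Complex.norm_real, Real.norm_eq_abs, abs_le]
    constructor <;> linarith
  have hs₀ball : s₀ ∈ ball c (η / 4) := mem_ball_iff_norm.2 (by linarith)
  have hs₀cl : s₀ ∈ closedBall c (η / 16) := mem_closedBall_iff_norm.2 hs₀c
  have hFs₀ : F s₀ ≠ 0 := h.ne_zero s₀ hs₀1
  have hψs₀ := hψ s₀ hs₀ball hFs₀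
  -- `ρ = β + iγ ∈ S`
  set ρ : ℂ := β + γ * I with hρ
  have hρS : ρ ∈ S := by
    refine hS' ρ hzero ?_
    have : ρ - c = ((β - 1 - η / 32 : ℝ) : ℂ) := by simp only [hρ, hcdef]; push_cast; ring
    rw [this, Complex.norm_real, Real.norm_eq_abs, abs_le]
    constructor <;> linarith
  have hSre : ∀ a ∈ S, a.re < s₀.re := by
    intro a ha
    have := h.re_le_one_of_zero (hS a ha).1
    rw [hs₀re]; linarith
  obtain ⟨-, hge⟩ := ClassicalZFRData.re_sum_div_ge (m := m) hSre
  have hρterm : ((s₀ - ρ)⁻¹).re = 1 / (1 + d - β) := by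
    have : s₀ - ρ = ((1 + d - β : ℝ) : ℂ) := by simp only [hs₀, hρ]; push_cast; ring
    rw [this, ← Complex.ofReal_inv, Complex.ofReal_re, one_div]
  have hsum_ge := hge ρ hρS (hS ρ hρS).2.1
  rw [hρterm] at hsum_ge
  -- `Re L(Λ₁, s₀) = −Re (ψ(s₀) + ∑)`
  have hL : LSeries Λ₁ s₀ = -(ψ s₀ + ∑ a ∈ S, (m a : ℂ) / (s₀ - a)) := by
    rw [hψs₀, h.logDeriv_eq s₀ hs₀1]; ring
  rw [hL, Complex.neg_re, Complex.add_re]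
  have := (Complex.abs_re_le_norm (ψ s₀)).trans (hψb s₀ hs₀cl)
  linarith [neg_abs_le (ψ s₀).re, le_abs_self (ψ s₀).re]

/-- Third inequality of MV (11.2) (no zero needed): for `0 < δ ≤ 3η/32` and real `t`,
`Re L(Λ₁, 1 + δ + it) ≤ E (log Q + log(|t| + 4))`.
[cite: MontgomeryVaughan2007, Theorem 11.3 (proof, eq. (11.2))] -/
theorem re_LSeries₁_le {E : ℝ}
    (hpack : ∀ t : ℝ, ∃ (S : Finset ℂ) (m : ℂ → ℕ) (ψ : ℂ → ℂ),
      (∀ a ∈ S, F a = 0 ∧ 0 < m a ∧ ‖a - (1 + η / 32 + t * I)‖ ≤ η / 4) ∧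
      (∀ a, F a = 0 → ‖a - (1 + η / 32 + t * I)‖ ≤ η / 4 → a ∈ S) ∧
      (∀ z ∈ ball (1 + η / 32 + t * I) (η / 4), F z ≠ 0 →
        ψ z = deriv F z / F z - ∑ a ∈ S, (m a : ℂ) / (z - a)) ∧
      (∀ z ∈ closedBall (1 + η / 32 + t * I) (η / 16),
        ‖ψ z‖ ≤ E * (Real.log Q + Real.log (|t| + 4))))
    {d : ℝ} (hd : 0 < d) (hd1 : d ≤ 3 * η / 32) (t : ℝ) :
    (LSeries Λ₁ (((1 + d : ℝ) : ℂ) + t * I)).re ≤ E * (Real.log Q + Real.log (|t| + 4)) := by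
  have hη := h.eta_pos
  obtain ⟨S, m, ψ, hS, -, hψ, hψb⟩ := hpack t
  set s₀ : ℂ := ((1 + d : ℝ) : ℂ) + t * I with hs₀
  have hs₀re : s₀.re = 1 + d := by simp [hs₀]
  have hs₀1 : 1 < s₀.re := by rw [hs₀re]; linarith
  set c : ℂ := 1 + η / 32 + t * I with hcdef
  have hs₀c : ‖s₀ - c‖ ≤ η / 16 := by
    have : s₀ - c = ((d - η / 32 : ℝ) : ℂ) := by simp only [hs₀, hcdef]; push_cast; ring
    rw [this, Complex.norm_real, Real.norm_eq_abs, abs_le]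
    constructor <;> linarith
  have hs₀ball : s₀ ∈ ball c (η / 4) := mem_ball_iff_norm.2 (by linarith)
  have hs₀cl : s₀ ∈ closedBall c (η / 16) := mem_closedBall_iff_norm.2 hs₀c
  have hFs₀ : F s₀ ≠ 0 := h.ne_zero s₀ hs₀1
  have hψs₀ := hψ s₀ hs₀ball hFs₀
  have hSre : ∀ a ∈ S, a.re < s₀.re := by
    intro a ha
    have := h.re_le_one_of_zero (hS a ha).1
    rw [hs₀re]; linarith
  obtain ⟨hnn, -⟩ := ClassicalZFRData.re_sum_div_ge (m := m) hSre
  have hL : LSeries Λ₁ s₀ = -(ψ s₀ + ∑ a ∈ S, (m a : ℂ) / (s₀ - a)) := by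
    rw [hψs₀, h.logDeriv_eq s₀ hs₀1]; ring
  rw [hL, Complex.neg_re, Complex.add_re]
  have := (Complex.abs_re_le_norm (ψ s₀)).trans (hψb s₀ hs₀cl)
  linarith [neg_abs_le (ψ s₀).re, le_abs_self (ψ s₀).re]

/-- **Case 3 input** (MV (11.3)): in the `pole` case, for a zero `β + iγ` with `γ ≠ 0` and
`|(β + iγ) − (1 + η/32)| ≤ η/4`, and `0 < δ ≤ 3η/32`,
`Re L(Λ₁, 1 + δ) ≤ E(log Q + log 4) − 2(1+δ−β)/((1+δ−β)² + γ²)`, the zeros `β ± iγ` (reflection)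
both lying in the disc at height `0`. [cite: MontgomeryVaughan2007, Theorem 11.3 (proof, Case 3, eq. (11.3))] -/
theorem re_LSeries₁_real_le_of_pair (hpole : pole = true) {E : ℝ}
    (hpack : ∀ t : ℝ, ∃ (S : Finset ℂ) (m : ℂ → ℕ) (ψ : ℂ → ℂ),
      (∀ a ∈ S, F a = 0 ∧ 0 < m a ∧ ‖a - (1 + η / 32 + t * I)‖ ≤ η / 4) ∧
      (∀ a, F a = 0 → ‖a - (1 + η / 32 + t * I)‖ ≤ η / 4 → a ∈ S) ∧
      (∀ z ∈ ball (1 + η / 32 + t * I) (η / 4), F z ≠ 0 →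
        ψ z = deriv F z / F z - ∑ a ∈ S, (m a : ℂ) / (z - a)) ∧
      (∀ z ∈ closedBall (1 + η / 32 + t * I) (η / 16),
        ‖ψ z‖ ≤ E * (Real.log Q + Real.log (|t| + 4))))
    {β γ d : ℝ} (hzero : F (β + γ * I) = 0) (hγ : γ ≠ 0)
    (hnear : ‖(β + γ * I : ℂ) - (1 + η / 32)‖ ≤ η / 4) (hd : 0 < d) (hd1 : d ≤ 3 * η / 32) :
    (LSeries Λ₁ ((1 + d : ℝ) : ℂ)).re ≤
      E * (Real.log Q + Real.log (|(0 : ℝ)| + 4)) -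
        2 * ((1 + d - β) / ((1 + d - β) ^ 2 + γ ^ 2)) := by
  have hη := h.eta_pos
  obtain ⟨S, m, ψ, hS, hS', hψ, hψb⟩ := hpack 0
  set c : ℂ := 1 + η / 32 + ((0 : ℝ) : ℂ) * I with hcdef
  have hc : c = 1 + η / 32 := by simp [hcdef]
  set s₀ : ℂ := ((1 + d : ℝ) : ℂ) with hs₀
  have hs₀re : s₀.re = 1 + d := by simp [hs₀]
  have hs₀1 : 1 < s₀.re := by rw [hs₀re]; linarith
  have hs₀c : ‖s₀ - c‖ ≤ η / 16 := by
    have : s₀ - c = ((d - η / 32 : ℝ) : ℂ) := by rw [hc, hs₀]; push_cast; ring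
    rw [this, Complex.norm_real, Real.norm_eq_abs, abs_le]
    constructor <;> linarith
  have hs₀ball : s₀ ∈ ball c (η / 4) := mem_ball_iff_norm.2 (by linarith)
  have hs₀cl : s₀ ∈ closedBall c (η / 16) := mem_closedBall_iff_norm.2 hs₀c
  have hFs₀ : F s₀ ≠ 0 := h.ne_zero s₀ hs₀1
  have hψs₀ := hψ s₀ hs₀ball hFs₀
  -- the two zeros
  set ρ₁ : ℂ := β + γ * I with hρ₁
  set ρ₂ : ℂ := conj ρ₁ with hρ₂
  have hρ₂eq : ρ₂ = β - γ * I := by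
    rw [hρ₂, hρ₁, map_add, map_mul, Complex.conj_ofReal, Complex.conj_ofReal, Complex.conj_I]
    ring
  have hρ₁re : 1 - η < ρ₁.re := by
    have h1 : |(ρ₁ - (1 + η / 32)).re| ≤ ‖ρ₁ - (1 + η / 32)‖ := Complex.abs_re_le_norm _
    have hre : (ρ₁ - (1 + η / 32)).re = β - (1 + η / 32) := by simp [hρ₁]
    rw [hre] at h1
    have := neg_abs_le (β - (1 + η / 32))
    have hb : ρ₁.re = β := by simp [hρ₁]
    rw [hb]; linarith
  have hzero₂ : F ρ₂ = 0 := h.reflect hpole ρ₁ hρ₁re hzero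
  have hρ₁S : ρ₁ ∈ S := hS' ρ₁ hzero (by rw [hc]; exact hnear)
  have hρ₂S : ρ₂ ∈ S := by
    refine hS' ρ₂ hzero₂ ?_
    rw [hc, hρ₂]
    have : (1 + (η : ℂ) / 32) = conj (1 + (η : ℂ) / 32) := by
      simp [map_div₀, map_ofNat, Complex.conj_ofReal]
    rw [this, ← map_sub, Complex.norm_conj]
    exact hnear
  have hne : ρ₁ ≠ ρ₂ := by
    intro h'
    have := congrArg Complex.im h'
    rw [hρ₂eq, hρ₁] at this
    simp at this
    exact hγ (by linarith)
  have hSre : ∀ a ∈ S, a.re < s₀.re := by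
    intro a ha
    have := h.re_le_one_of_zero (hS a ha).1
    rw [hs₀re]; linarith
  have hpair := DirichletZFR.re_sum_div_ge_pair hSre (fun a ha ↦ (hS a ha).2.1) hρ₁S hρ₂S hne
  have h₁ : ((s₀ - ρ₁)⁻¹).re = (1 + d - β) / ((1 + d - β) ^ 2 + γ ^ 2) := by
    have : s₀ - ρ₁ = ((1 + d - β : ℝ) : ℂ) + ((-γ : ℝ) : ℂ) * I := by
      rw [hs₀, hρ₁]; push_cast; ring
    rw [this, DirichletZFR.re_inv_ofReal_add_mul_I]; ring
  have h₂ : ((s₀ - ρ₂)⁻¹).re = (1 + d - β) / ((1 + d - β) ^ 2 + γ ^ 2) := by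
    have : s₀ - ρ₂ = ((1 + d - β : ℝ) : ℂ) + ((γ : ℝ) : ℂ) * I := by
      rw [hs₀, hρ₂eq]; push_cast; ring
    rw [this, DirichletZFR.re_inv_ofReal_add_mul_I]
  rw [h₁, h₂] at hpair
  have hL : LSeries Λ₁ s₀ = -(ψ s₀ + ∑ a ∈ S, (m a : ℂ) / (s₀ - a)) := by
    rw [hψs₀, h.logDeriv_eq s₀ hs₀1]; ring
  rw [hL, Complex.neg_re, Complex.add_re]
  have hψn := (Complex.abs_re_le_norm (ψ s₀)).trans (hψb s₀ hs₀cl)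
  have hψre : -(ψ s₀).re ≤ E * (Real.log Q + Real.log (|(0 : ℝ)| + 4)) := by
    linarith [neg_abs_le (ψ s₀).re]
  have hsum : 2 * ((1 + d - β) / ((1 + d - β) ^ 2 + γ ^ 2)) ≤
      (∑ a ∈ S, (m a : ℂ) / (s₀ - a)).re := by linarith [hpair]
  linear_combination hψre + hsum

/-- The companion bound at `1 + δ + iu` with the pole term evaluated:
`Re L(Λ₂, 1 + δ + iu) ≤ δ/(δ² + u²) + C₂(log Q + log(|u| + 4))` for `0 < δ ≤ 1`.
[cite: MontgomeryVaughan2007, Theorem 11.3 (proof, Case 2)] -/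
theorem re_LSeries₂_le_of_pos {d : ℝ} (hd : 0 < d) (hd1 : d ≤ 1) (u : ℝ) :
    (LSeries Λ₂ (((1 + d : ℝ) : ℂ) + u * I)).re ≤
      d / (d ^ 2 + u ^ 2) + C₂ * (Real.log Q + Real.log (|u| + 4)) := by
  set s : ℂ := ((1 + d : ℝ) : ℂ) + u * I with hs
  have hsre : s.re = 1 + d := by simp [hs]
  have hsim : s.im = u := by simp [hs]
  have h1 := h.re_LSeries₂_le_pole s (by rw [hsre]; linarith) (by rw [hsre]; linarith)
  rw [hsim] at h1
  have h2 : (1 / (s - 1)).re = d / (d ^ 2 + u ^ 2) := by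
    have : s - 1 = ((d : ℝ) : ℂ) + ((u : ℝ) : ℂ) * I := by rw [hs]; push_cast; ring
    rw [one_div, this, DirichletZFR.re_inv_ofReal_add_mul_I]
  linarith

end Inequalities

/-! ## The cases of the proof of MV Theorem 11.3 -/

section Cases

variable (h : UniformTwistedZFRData η A Cg c₁ K₀ C₂ pole Q Λ₀ Λ₁ Λ₂ F)
include h

/-- **A zero on the line `σ = 1` off the real axis is impossible** (this replaces the input
"`L(1 + it, χ) ≠ 0`", not assumed here): if `F(1 + iγ) = 0` with `γ ≠ 0`, then `3-4-1` at
`σ = 1 + δ` gives `1/δ ≤ 3K₀ℒ₀ + (4E + 2C₂)ℒ + 1/(4|γ|)` for every small `δ > 0`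
(`δ/(δ² + 4γ²) ≤ 1/(4|γ|)`), which fails for `δ` small. [cite: MontgomeryVaughan2007, Theorem 11.3 (proof)] -/
theorem not_zero_of_re_eq_one {E : ℝ} (hE : 0 ≤ E)
    (hpack : ∀ t : ℝ, ∃ (S : Finset ℂ) (m : ℂ → ℕ) (ψ : ℂ → ℂ),
      (∀ a ∈ S, F a = 0 ∧ 0 < m a ∧ ‖a - (1 + η / 32 + t * I)‖ ≤ η / 4) ∧
      (∀ a, F a = 0 → ‖a - (1 + η / 32 + t * I)‖ ≤ η / 4 → a ∈ S) ∧
      (∀ z ∈ ball (1 + η / 32 + t * I) (η / 4), F z ≠ 0 →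
        ψ z = deriv F z / F z - ∑ a ∈ S, (m a : ℂ) / (z - a)) ∧
      (∀ z ∈ closedBall (1 + η / 32 + t * I) (η / 16),
        ‖ψ z‖ ≤ E * (Real.log Q + Real.log (|t| + 4))))
    {β γ : ℝ} (hzero : F (β + γ * I) = 0) (hβ : β = 1) (hγ : γ ≠ 0) : False := by
  have hη := h.eta_pos
  have hη1 := h.eta_le_one
  have hK₀ := h.K₀_nonneg
  have hC₂ := h.C₂_nonneg
  have hQ := h.one_le_Q
  set ℒ : ℝ := Real.log Q + Real.log (|γ| + 4) with hℒ
  have hℒ1 : 1 ≤ ℒ := TwistedZFR.one_le_ell hQ γ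
  have hℒ₀1 : 1 ≤ Real.log Q + Real.log 4 := log_add_log_four_ge hQ
  have hγ0 : 0 < |γ| := abs_pos.2 hγ
  obtain ⟨X, hX⟩ : ∃ X : ℝ, X = 3 * (K₀ * (Real.log Q + Real.log 4)) + 4 * (E * ℒ) + 2 * C₂ * ℒ +
      1 / (4 * |γ|) := ⟨_, rfl⟩
  have hX0 : 0 ≤ X := by
    rw [hX]
    have : 0 ≤ K₀ * (Real.log Q + Real.log 4) := mul_nonneg hK₀ (by linarith)
    positivity
  have h32 : 0 < 32 / (3 * η) := by positivity
  obtain ⟨d, hddef⟩ : ∃ d : ℝ, d = 1 / (X + 32 / (3 * η) + 1) := ⟨_, rfl⟩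
  have hden : 0 < X + 32 / (3 * η) + 1 := by positivity
  have hdpos : 0 < d := by rw [hddef]; positivity
  have hd_inv : 1 / d = X + 32 / (3 * η) + 1 := by rw [hddef, one_div_one_div]
  have hd1 : d ≤ 3 * η / 32 := by
    have h1 : d ≤ 1 / (32 / (3 * η)) := by
      rw [hddef]
      exact div_le_div_of_nonneg_left zero_le_one h32 (by linarith)
    rw [one_div_div] at h1
    linarith
  have hd1' : d ≤ 1 := by linarith
  -- the three inequalities at `σ = 1 + d`
  have hA := h.re_LSeries₀_le_of_pos hdpos hd1'
  have hB := h.re_LSeries₁_le_of_zero hpack hzero (by rw [hβ]; linarith) hdpos hd1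
  rw [hβ, show 1 + d - (1 : ℝ) = d by ring] at hB
  have hC := h.re_LSeries₂_le_of_pos hdpos hd1' (2 * γ)
  have h341 := h.three_four_one (1 + d) (by linarith) γ
  have hpt : ((1 + d : ℝ) : ℂ) + 2 * γ * I = ((1 + d : ℝ) : ℂ) + ((2 * γ : ℝ) : ℂ) * I := by
    push_cast; ring
  rw [hpt] at h341
  -- the pole term `d/(d² + 4γ²) ≤ 1/(4|γ|)`
  have hpole : d / (d ^ 2 + (2 * γ) ^ 2) ≤ 1 / (4 * |γ|) := by
    rw [div_le_div_iff₀ (by positivity) (by positivity)]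
    have hsq : (2 * γ) ^ 2 = 4 * |γ| ^ 2 := by rw [mul_pow, sq_abs]; norm_num
    rw [hsq]
    nlinarith [sq_nonneg (d - 2 * |γ|)]
  have h2 := TwistedZFR.ell_two_mul_le hQ γ
  have hC' : (LSeries Λ₂ (((1 + d : ℝ) : ℂ) + ((2 * γ : ℝ) : ℂ) * I)).re ≤
      1 / (4 * |γ|) + 2 * C₂ * ℒ := by
    refine hC.trans ?_
    have : C₂ * (Real.log Q + Real.log (|2 * γ| + 4)) ≤ C₂ * (2 * ℒ) :=
      mul_le_mul_of_nonneg_left h2 hC₂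
    linarith
  -- combine: `1/d ≤ X`
  have hkey : 1 / d ≤ 3 * (K₀ * (Real.log Q + Real.log 4)) + 4 * (E * ℒ) + 2 * C₂ * ℒ +
      1 / (4 * |γ|) := by
    linear_combination h341 + 3 * hA + 4 * hB + hC'
  rw [hd_inv, ← hX] at hkey
  linarith

/-- **Case 1 of MV Theorem 11.3** (no pole, e.g. complex `ν²`): a zero `β + iγ` of `F` with
`β ≥ 1 − 7η/32` satisfies `1 − β ≥ 1/(14 E₁ ℒ)`, `ℒ = log Q + log(|γ| + 4)`,
`E₁ = 3K₀ + 4E + 2C₂ + 6/η`: from `3-4-1` and (11.2), `4/(1 + δ − β) ≤ 3/δ + E₁ ℒ`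
(`K₀(log Q + log 4) ≤ K₀ℒ`), and
`δ = 1/(2E₁ℒ) (≤ 3η/32)` gives the claim. [cite: MontgomeryVaughan2007, Theorem 11.3 (proof, Case 1)] -/
theorem one_sub_re_ge_of_noPole (hpole : pole = false) {E : ℝ} (hE : 0 ≤ E)
    (hpack : ∀ t : ℝ, ∃ (S : Finset ℂ) (m : ℂ → ℕ) (ψ : ℂ → ℂ),
      (∀ a ∈ S, F a = 0 ∧ 0 < m a ∧ ‖a - (1 + η / 32 + t * I)‖ ≤ η / 4) ∧
      (∀ a, F a = 0 → ‖a - (1 + η / 32 + t * I)‖ ≤ η / 4 → a ∈ S) ∧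
      (∀ z ∈ ball (1 + η / 32 + t * I) (η / 4), F z ≠ 0 →
        ψ z = deriv F z / F z - ∑ a ∈ S, (m a : ℂ) / (z - a)) ∧
      (∀ z ∈ closedBall (1 + η / 32 + t * I) (η / 16),
        ‖ψ z‖ ≤ E * (Real.log Q + Real.log (|t| + 4))))
    {β γ : ℝ} (hzero : F (β + γ * I) = 0) (hβ : 1 - 7 * η / 32 ≤ β) :
    1 / (14 * (3 * K₀ + 4 * E + 2 * C₂ + 6 / η) * (Real.log Q + Real.log (|γ| + 4))) ≤ 1 - β := by
  have hη := h.eta_pos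
  have hη1 := h.eta_le_one
  have hK₀ := h.K₀_nonneg
  have hC₂ := h.C₂_nonneg
  have hQ := h.one_le_Q
  set E₁ : ℝ := 3 * K₀ + 4 * E + 2 * C₂ + 6 / η with hE₁
  have hℒ1 : 1 ≤ Real.log Q + Real.log (|γ| + 4) := TwistedZFR.one_le_ell hQ γ
  have hℒ0 : 0 < Real.log Q + Real.log (|γ| + 4) := by linarith
  have h6η : 6 ≤ 6 / η := by rw [le_div_iff₀ hη]; nlinarith
  have hE₁6 : 6 / η ≤ E₁ := by rw [hE₁]; linarith
  have h6pos : 0 < 6 / η := by positivity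
  have hE₁0 : 0 < E₁ := by linarith
  have hβ1 : β ≤ 1 := by have := h.re_le_one_of_zero hzero; simpa using this
  -- `δ = 1/(2 E₁ ℒ)`
  set d : ℝ := 1 / (2 * E₁ * (Real.log Q + Real.log (|γ| + 4))) with hddef
  have hdpos : 0 < d := by positivity
  have hd1 : d ≤ 3 * η / 32 := by
    have h1 : d ≤ 1 / (2 * E₁) := by
      rw [hddef]; exact div_le_div_of_nonneg_left zero_le_one (by positivity) (by nlinarith)
    have h2 : 1 / (2 * E₁) ≤ 1 / (2 * (6 / η)) :=
      div_le_div_of_nonneg_left zero_le_one (by positivity) (by linarith)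
    have h3 : 1 / (2 * (6 / η)) = η / 12 := by field_simp; ring
    linarith
  have hd1' : d ≤ 1 := by linarith
  -- the three inequalities
  have hA := h.re_LSeries₀_le_of_pos hdpos hd1'
  have hB := h.re_LSeries₁_le_of_zero hpack hzero hβ hdpos hd1
  have hC := h.re_LSeries₂_le_noPole hpole (((1 + d : ℝ) : ℂ) + ((2 * γ : ℝ) : ℂ) * I)
    (by simp; linarith) (by simp; linarith)
  have h341 := h.three_four_one (1 + d) (by linarith) γ
  have hpt : ((1 + d : ℝ) : ℂ) + 2 * γ * I = ((1 + d : ℝ) : ℂ) + ((2 * γ : ℝ) : ℂ) * I := by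
    push_cast; ring
  rw [hpt] at h341
  have h2 := TwistedZFR.ell_two_mul_le hQ γ
  set ℒ : ℝ := Real.log Q + Real.log (|γ| + 4) with hℒ
  have hC' : (LSeries Λ₂ (((1 + d : ℝ) : ℂ) + ((2 * γ : ℝ) : ℂ) * I)).re ≤ 2 * C₂ * ℒ := by
    refine hC.trans ?_
    have him : (((1 + d : ℝ) : ℂ) + ((2 * γ : ℝ) : ℂ) * I).im = 2 * γ := by simp
    rw [him]
    calc C₂ * (Real.log Q + Real.log (|2 * γ| + 4)) ≤ C₂ * (2 * ℒ) := by gcongr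
      _ = 2 * C₂ * ℒ := by ring
  -- `4/(1+δ−β) ≤ 3/δ + (3K₀ + 4E + 2C₂)ℒ ≤ 7 E₁ ℒ`
  have hkey : 4 / (1 + d - β) ≤ 7 * E₁ * ℒ := by
    have h3d : 3 / d = 6 * E₁ * ℒ := by rw [hddef]; field_simp; norm_num
    have hK₀ℒ : K₀ * (Real.log Q + Real.log 4) ≤ K₀ * ℒ :=
      mul_le_mul_of_nonneg_left (log_add_log_four_le Q γ) hK₀
    have h6 : 4 / (1 + d - β) ≤
        3 / d + 3 * (K₀ * (Real.log Q + Real.log 4)) + 4 * (E * ℒ) + 2 * C₂ * ℒ := by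
      linear_combination h341 + 3 * hA + 4 * hB + hC'
    have h7 : 3 * (K₀ * ℒ) + 4 * (E * ℒ) + 2 * C₂ * ℒ ≤ E₁ * ℒ := by
      rw [hE₁]
      have : 0 ≤ 6 / η * ℒ := by positivity
      nlinarith
    linarith
  -- conclude
  have hpos : 0 < 1 + d - β := by linarith
  have hgap : 4 / (7 * E₁ * ℒ) ≤ 1 + d - β := by
    rw [div_le_iff₀ (by positivity)]
    rw [div_le_iff₀ hpos] at hkey
    linarith
  have : 1 / (14 * E₁ * ℒ) = 4 / (7 * E₁ * ℒ) - d := by rw [hddef]; field_simp; norm_num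
  linarith

/-- **Case 2 of MV Theorem 11.3** (`pole`, `|γ| ≥ 6(1 − β)`): a zero `β + iγ` of `F` with
`0 < 1 − β ≤ η/64` and `|γ| ≥ 6(1 − β)` satisfies `1 − β ≥ 4/(105 E₂ ℒ)`,
`E₂ = 3K₀ + 4E + 2C₂ + 1`: with `δ = 6(1 − β)` the pole term is `δ/(δ² + 4γ²) ≤ 1/(30(1−β))`, and
`3/6 − 4/7 + 1/30 = −4/105`. [cite: MontgomeryVaughan2007, Theorem 11.3 (proof, Case 2)] -/
theorem one_sub_re_ge_of_pole_far {E : ℝ} (hE : 0 ≤ E)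
    (hpack : ∀ t : ℝ, ∃ (S : Finset ℂ) (m : ℂ → ℕ) (ψ : ℂ → ℂ),
      (∀ a ∈ S, F a = 0 ∧ 0 < m a ∧ ‖a - (1 + η / 32 + t * I)‖ ≤ η / 4) ∧
      (∀ a, F a = 0 → ‖a - (1 + η / 32 + t * I)‖ ≤ η / 4 → a ∈ S) ∧
      (∀ z ∈ ball (1 + η / 32 + t * I) (η / 4), F z ≠ 0 →
        ψ z = deriv F z / F z - ∑ a ∈ S, (m a : ℂ) / (z - a)) ∧
      (∀ z ∈ closedBall (1 + η / 32 + t * I) (η / 16),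
        ‖ψ z‖ ≤ E * (Real.log Q + Real.log (|t| + 4))))
    {β γ : ℝ} (hzero : F (β + γ * I) = 0) (hβ1 : β < 1)
    (hsmall : 1 - β ≤ η / 64) (hfar : 6 * (1 - β) ≤ |γ|) :
    4 / (105 * (3 * K₀ + 4 * E + 2 * C₂ + 1) * (Real.log Q + Real.log (|γ| + 4))) ≤ 1 - β := by
  have hη := h.eta_pos
  have hη1 := h.eta_le_one
  have hK₀ := h.K₀_nonneg
  have hC₂ := h.C₂_nonneg
  have hQ := h.one_le_Q
  have hℒ1 : 1 ≤ Real.log Q + Real.log (|γ| + 4) := TwistedZFR.one_le_ell hQ γ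
  set u : ℝ := 1 - β with hu
  have hu0 : 0 < u := by rw [hu]; linarith
  set d : ℝ := 6 * u with hddef
  have hdpos : 0 < d := by positivity
  have hd1 : d ≤ 3 * η / 32 := by rw [hddef]; linarith
  have hd1' : d ≤ 1 := by linarith
  have hβ : 1 - 7 * η / 32 ≤ β := by linarith
  -- the three inequalities
  have hA := h.re_LSeries₀_le_of_pos hdpos hd1'
  have hB := h.re_LSeries₁_le_of_zero hpack hzero hβ hdpos hd1
  have hCζ := h.re_LSeries₂_le_of_pos hdpos hd1' (2 * γ)
  have h341 := h.three_four_one (1 + d) (by linarith) γ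
  have hpt : ((1 + d : ℝ) : ℂ) + 2 * γ * I = ((1 + d : ℝ) : ℂ) + ((2 * γ : ℝ) : ℂ) * I := by
    push_cast; ring
  rw [hpt] at h341
  have h2 := TwistedZFR.ell_two_mul_le hQ γ
  set ℒ : ℝ := Real.log Q + Real.log (|γ| + 4) with hℒ
  have hℒ0 : 0 < ℒ := by linarith
  -- the pole term `δ/(δ² + 4γ²) ≤ 1/(30 u)`
  have hγ2 : 36 * u ^ 2 ≤ γ ^ 2 := by
    have h6u : 0 ≤ 6 * u := by positivity
    have := mul_le_mul hfar hfar h6u (abs_nonneg γ)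
    rw [← pow_two, ← pow_two, sq_abs] at this
    nlinarith
  have hpole : d / (d ^ 2 + (2 * γ) ^ 2) ≤ 1 / (30 * u) := by
    rw [div_le_div_iff₀ (by positivity) (by positivity), hddef]
    nlinarith
  have hC' : (LSeries Λ₂ (((1 + d : ℝ) : ℂ) + ((2 * γ : ℝ) : ℂ) * I)).re ≤
      1 / (30 * u) + 2 * C₂ * ℒ := by
    refine hCζ.trans ?_
    have : C₂ * (Real.log Q + Real.log (|2 * γ| + 4)) ≤ C₂ * (2 * ℒ) :=
      mul_le_mul_of_nonneg_left h2 hC₂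
    linarith
  -- combine: `(4/105)/u ≤ 3K₀ℒ₀ + (4E + 2C₂)ℒ ≤ E₂ ℒ`
  have h1d : 1 / d = 1 / (6 * u) := by rw [hddef]
  have h1β : 1 / (1 + d - β) = 1 / (7 * u) := by rw [hddef, hu]; ring_nf
  rw [h1d] at hA
  rw [h1β] at hB
  have hkey : (4 / 105) / u ≤ 3 * (K₀ * (Real.log Q + Real.log 4)) + 4 * (E * ℒ) + 2 * C₂ * ℒ := by
    have e : (4 / 105) / u = -(3 * (1 / (6 * u)) - 4 * (1 / (7 * u)) + 1 / (30 * u)) := by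
      field_simp; norm_num
    rw [e]
    linear_combination h341 + 3 * hA + 4 * hB + hC'
  have hK₀ℒ : K₀ * (Real.log Q + Real.log 4) ≤ K₀ * ℒ :=
    mul_le_mul_of_nonneg_left (log_add_log_four_le Q γ) hK₀
  set E₂ : ℝ := 3 * K₀ + 4 * E + 2 * C₂ + 1 with hE₂
  have hE₂0 : 0 < E₂ := by rw [hE₂]; positivity
  have hkey2 : (4 / 105) / u ≤ E₂ * ℒ := by
    have : 3 * (K₀ * ℒ) + 4 * (E * ℒ) + 2 * C₂ * ℒ ≤ E₂ * ℒ := by rw [hE₂]; nlinarith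
    linarith
  rw [div_le_iff₀ (by positivity)]
  rw [div_le_iff₀ hu0] at hkey2
  nlinarith

/-- **Case 3 of MV Theorem 11.3** (`pole`, `0 < |γ| < 6(1 − β)`): a zero `β + iγ` of `F` with
`γ ≠ 0`, `|γ| < 6(1 − β)` and `0 < 1 − β ≤ 3η/416` satisfies `1 − β ≥ 33/(754 E₃ (log Q + log 4))`,
`E₃ = K₀ + E + 1`: at `σ = 1 + 13(1 − β)` the conjugate pair contributes
`2(σ−β)/((σ−β)² + γ²) ≥ 7/(58(1−β))` in (11.3)–(11.4), and `1/13 − 7/58 = −33/754`.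
[cite: MontgomeryVaughan2007, Theorem 11.3 (proof, Case 3)] -/
theorem one_sub_re_ge_of_pole_near (hpole : pole = true) {E : ℝ} (hE : 0 ≤ E)
    (hpack : ∀ t : ℝ, ∃ (S : Finset ℂ) (m : ℂ → ℕ) (ψ : ℂ → ℂ),
      (∀ a ∈ S, F a = 0 ∧ 0 < m a ∧ ‖a - (1 + η / 32 + t * I)‖ ≤ η / 4) ∧
      (∀ a, F a = 0 → ‖a - (1 + η / 32 + t * I)‖ ≤ η / 4 → a ∈ S) ∧
      (∀ z ∈ ball (1 + η / 32 + t * I) (η / 4), F z ≠ 0 →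
        ψ z = deriv F z / F z - ∑ a ∈ S, (m a : ℂ) / (z - a)) ∧
      (∀ z ∈ closedBall (1 + η / 32 + t * I) (η / 16),
        ‖ψ z‖ ≤ E * (Real.log Q + Real.log (|t| + 4))))
    {β γ : ℝ} (hzero : F (β + γ * I) = 0) (hγ : γ ≠ 0) (hβ1 : β < 1)
    (hsmall : 1 - β ≤ 3 * η / 416) (hnearγ : |γ| < 6 * (1 - β)) :
    33 / (754 * (K₀ + E + 1) * (Real.log Q + Real.log (|(0 : ℝ)| + 4))) ≤ 1 - β := by
  have hη := h.eta_pos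
  have hη1 := h.eta_le_one
  have hK₀ := h.K₀_nonneg
  have hQ := h.one_le_Q
  have hℒ1 : 1 ≤ Real.log Q + Real.log (|(0 : ℝ)| + 4) := TwistedZFR.one_le_ell hQ 0
  set u : ℝ := 1 - β with hu
  have hu0 : 0 < u := by rw [hu]; linarith
  set d : ℝ := 13 * u with hddef
  have hdpos : 0 < d := by positivity
  have hd1 : d ≤ 3 * η / 32 := by rw [hddef]; linarith
  have hd1' : d ≤ 1 := by linarith
  -- the zero lies in the disc at height `0`
  have hnear : ‖(β + γ * I : ℂ) - (1 + η / 32)‖ ≤ η / 4 := by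
    have h1 := Complex.norm_le_abs_re_add_abs_im ((β + γ * I : ℂ) - (1 + η / 32))
    have hre : ((β + γ * I : ℂ) - (1 + η / 32)).re = β - (1 + η / 32) := by simp
    have him : ((β + γ * I : ℂ) - (1 + η / 32)).im = γ := by simp
    rw [hre, him] at h1
    have h2 : |β - (1 + η / 32)| ≤ η / 32 + u := by
      rw [abs_le]; constructor <;> linarith
    have h3 : |γ| ≤ 6 * u := hnearγ.le
    linarith
  -- the two inequalities
  have hA := h.re_LSeries₀_le_of_pos hdpos hd1'
  have hP := h.re_LSeries₁_real_le_of_pair hpole hpack hzero hγ hnear hdpos hd1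
  have h114 := TwistedZFR.re_add_re_nonneg h.norm_le₁ h.summable (σ := 1 + d) (by linarith)
  set ℒ₀ : ℝ := Real.log Q + Real.log (|(0 : ℝ)| + 4) with hℒ₀
  have hℒ0 : 0 < ℒ₀ := by linarith
  -- the pair term `2(1+d−β)/((1+d−β)²+γ²) ≥ 7/(58u)`
  have hγ2 : γ ^ 2 ≤ 36 * u ^ 2 := by
    have h6u : 0 ≤ 6 * u := by positivity
    have := mul_le_mul hnearγ.le hnearγ.le (abs_nonneg γ) h6u
    rw [← pow_two, ← pow_two, sq_abs] at this
    nlinarith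
  have h14 : 1 + d - β = 14 * u := by rw [hddef, hu]; ring
  rw [h14] at hP
  have hpair : 7 / (58 * u) ≤ 2 * ((14 * u) / ((14 * u) ^ 2 + γ ^ 2)) := by
    rw [mul_div_assoc', div_le_div_iff₀ (by positivity) (by positivity)]
    nlinarith
  have h1d : 1 / d = 1 / (13 * u) := by rw [hddef]
  rw [h1d] at hA
  have hℒ₀eq : Real.log Q + Real.log 4 = ℒ₀ := by rw [hℒ₀, abs_zero, zero_add]
  rw [hℒ₀eq] at hA
  have hkey : (33 / 754) / u ≤ K₀ * ℒ₀ + E * ℒ₀ := by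
    have e : (33 / 754) / u = -(1 / (13 * u) - 7 / (58 * u)) := by
      field_simp; norm_num
    rw [e]
    linear_combination h114 + hA + hP + hpair
  set E₃ : ℝ := K₀ + E + 1 with hE₃
  have hE₃0 : 0 < E₃ := by rw [hE₃]; positivity
  have hkey2 : (33 / 754) / u ≤ E₃ * ℒ₀ := by
    have : K₀ * ℒ₀ + E * ℒ₀ ≤ E₃ * ℒ₀ := by rw [hE₃]; nlinarith
    linarith
  rw [div_le_iff₀ (by positivity)]
  rw [div_le_iff₀ hu0] at hkey2
  nlinarith

end Cases

/-! ## MV Theorem 11.3, abstract form -/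

section ZeroFree

variable (h : UniformTwistedZFRData η A Cg c₁ K₀ C₂ pole Q Λ₀ Λ₁ Λ₂ F)
include h

/-- **The zero-free region (Montgomery–Vaughan Theorem 11.3, abstract twisted form).** Let
`E = E(η, A, C_g, c₁)` be the package constant, `E₁ = 3K₀ + 4E + 2C₂ + 6/η`,
`E₂ = 3K₀ + 4E + 2C₂ + 1`, `E₃ = K₀ + E + 1`. If
`0 < c ≤ min(1/(14E₁), 4/(105E₂), 33/(754E₃), 3η/416)` — a bound depending only on
`η, A, C_g, c₁, K₀, C₂` — then every zero `ρ = β + iγ` of `F` with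
`β > 1 − c/(log Q + log(|γ| + 4))` is real, and exists only if `pole = true`. Proof: Case 1 if
`pole = false`; if `pole = true` and `γ ≠ 0`: `β = 1` is excluded by `not_zero_of_re_eq_one`,
and `β < 1` by Cases 2 (`|γ| ≥ 6(1−β)`) and 3 (`|γ| < 6(1−β)`). [cite: MontgomeryVaughan2007, Theorem 11.3] -/
theorem zeroFree_of_le {c : ℝ} (hc : 0 < c)
    (hc1 : c ≤ 1 / (14 * (3 * K₀ + 4 * E[η, A, Cg, c₁] + 2 * C₂ + 6 / η)))
    (hc2 : c ≤ 4 / (105 * (3 * K₀ + 4 * E[η, A, Cg, c₁] + 2 * C₂ + 1)))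
    (hc3 : c ≤ 33 / (754 * (K₀ + E[η, A, Cg, c₁] + 1)))
    (hc4 : c ≤ 3 * η / 416)
    {ρ : ℂ} (hzero : F ρ = 0)
    (hregion : 1 - c / (Real.log Q + Real.log (|ρ.im| + 4)) < ρ.re) :
    pole = true ∧ ρ.im = 0 := by
  have hη := h.eta_pos
  have hK₀ := h.K₀_nonneg
  have hC₂ := h.C₂_nonneg
  have hQ := h.one_le_Q
  obtain ⟨E, hEdef⟩ : ∃ E : ℝ, E = E[η, A, Cg, c₁] := ⟨_, rfl⟩
  have hE : 0 ≤ E := by rw [hEdef]; exact h.packageConst_nonneg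
  rw [← hEdef] at hc1 hc2 hc3
  have hpack := h.exists_package
  rw [← hEdef] at hpack
  set E₁ : ℝ := 3 * K₀ + 4 * E + 2 * C₂ + 6 / η with hE₁
  set E₂ : ℝ := 3 * K₀ + 4 * E + 2 * C₂ + 1 with hE₂
  set E₃ : ℝ := K₀ + E + 1 with hE₃
  have h6pos : 0 < 6 / η := by positivity
  have hE₁0 : 0 < E₁ := by rw [hE₁]; positivity
  have hE₂0 : 0 < E₂ := by rw [hE₂]; positivity
  have hE₃0 : 0 < E₃ := by rw [hE₃]; positivity
  set β : ℝ := ρ.re with hβdef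
  set γ : ℝ := ρ.im with hγdef
  have hρ : ρ = β + γ * I := (Complex.re_add_im ρ).symm.trans (by simp [hβdef, hγdef, mul_comm])
  have hzero' : F (β + γ * I) = 0 := by rw [← hρ]; exact hzero
  set ℒ : ℝ := Real.log Q + Real.log (|γ| + 4) with hℒ
  have hℒ1 : 1 ≤ ℒ := TwistedZFR.one_le_ell hQ γ
  have hℒ0 : 0 < ℒ := by linarith
  have hβ1 : β ≤ 1 := h.re_le_one_of_zero hzero
  have hgap : 1 - β < c / ℒ := by linarith
  have hcℒ : c / ℒ ≤ c := div_le_self hc.le hℒ1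
  have hsmall : 1 - β < 3 * η / 416 := by linarith
  have hβ' : 1 - 7 * η / 32 ≤ β := by linarith
  have hdiv : ∀ K' : ℝ, c ≤ K' → c / ℒ ≤ K' / ℒ := fun K' hK' ↦
    div_le_div_of_nonneg_right hK' hℒ0.le
  cases hp : pole with
  | false =>
    -- Case 1
    exfalso
    subst hp
    have h1 := h.one_sub_re_ge_of_noPole rfl hE hpack hzero' hβ'
    have h' : 1 / (14 * E₁ * ℒ) = (1 / (14 * E₁)) / ℒ := by rw [div_div]
    rw [h'] at h1
    linarith [hdiv _ hc1]
  | true =>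
    refine ⟨rfl, ?_⟩
    subst hp
    by_contra hγ0
    rcases eq_or_lt_of_le hβ1 with hβe | hβlt
    · exact h.not_zero_of_re_eq_one hE hpack hzero' hβe hγ0
    rcases le_or_gt (6 * (1 - β)) |γ| with hfar | hnear
    · -- Case 2
      have h2 := h.one_sub_re_ge_of_pole_far hE hpack hzero' hβlt (by linarith) hfar
      have h' : 4 / (105 * E₂ * ℒ) = (4 / (105 * E₂)) / ℒ := by rw [div_div]
      rw [h'] at h2
      linarith [hdiv _ hc2]
    · -- Case 3
      have h3 := h.one_sub_re_ge_of_pole_near rfl hE hpack hzero' hγ0 hβlt hsmall.le hnear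
      set ℒ₀ : ℝ := Real.log Q + Real.log (|(0 : ℝ)| + 4) with hℒ₀
      have hℒ₀1 : 1 ≤ ℒ₀ := TwistedZFR.one_le_ell hQ 0
      have hℒ₀ℒ : ℒ₀ ≤ ℒ := TwistedZFR.ell_zero_le Q γ
      have h' : 33 / (754 * E₃ * ℒ₀) = (33 / (754 * E₃)) / ℒ₀ := by rw [div_div]
      rw [h'] at h3
      have h4 : (33 / (754 * E₃)) / ℒ ≤ (33 / (754 * E₃)) / ℒ₀ :=
        div_le_div_of_nonneg_left (by positivity) (by linarith) hℒ₀ℒ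
      linarith [hdiv _ hc3]

end ZeroFree

/-- **The zero-free region with the constant quantified before the data**: for all numeric
parameters `η > 0`, `A ≥ 0`, `C_g`, `c₁`, `K₀ ≥ 0`, `C₂ ≥ 0` there is `c > 0` such that for EVERY
datum `UniformTwistedZFRData η A C_g c₁ K₀ C₂ pole Q Λ₀ Λ₁ Λ₂ F` (any `Q`, any twist), every
zero `ρ` of `F` with `Re ρ > 1 − c/(log Q + log(|Im ρ| + 4))` is real and `pole = true`. This is
the uniformity in the field, the conductor and the character of MV Theorem 11.3 /
Lagarias–Odlyzko Lemma 8.1 / Thorner–Zaman Theorem 3.1.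
[cite: MontgomeryVaughan2007, Theorem 11.3] -/
theorem exists_zeroFree_const {η A Cg c₁ K₀ C₂ : ℝ} (hη : 0 < η) (hA : 0 ≤ A) (hK₀ : 0 ≤ K₀)
    (hC₂ : 0 ≤ C₂) :
    ∃ c : ℝ, 0 < c ∧ ∀ (pole : Bool) (Q : ℝ) (Λ₀ : ℕ → ℝ) (Λ₁ Λ₂ : ℕ → ℂ) (F : ℂ → ℂ),
      UniformTwistedZFRData η A Cg c₁ K₀ C₂ pole Q Λ₀ Λ₁ Λ₂ F → ∀ ρ : ℂ, F ρ = 0 →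
        1 - c / (Real.log Q + Real.log (|ρ.im| + 4)) < ρ.re → pole = true ∧ ρ.im = 0 := by
  obtain ⟨E, hEdef⟩ : ∃ E : ℝ, E = E[η, A, Cg, c₁] := ⟨_, rfl⟩
  have hE : 0 ≤ E := by rw [hEdef]; positivity
  set E₁ : ℝ := 3 * K₀ + 4 * E + 2 * C₂ + 6 / η with hE₁
  set E₂ : ℝ := 3 * K₀ + 4 * E + 2 * C₂ + 1 with hE₂
  set E₃ : ℝ := K₀ + E + 1 with hE₃
  have h6pos : 0 < 6 / η := by positivity
  have hE₁0 : 0 < E₁ := by rw [hE₁]; positivity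
  have hE₂0 : 0 < E₂ := by rw [hE₂]; positivity
  have hE₃0 : 0 < E₃ := by rw [hE₃]; positivity
  set c : ℝ := min (min (1 / (14 * E₁)) (4 / (105 * E₂))) (min (33 / (754 * E₃)) (3 * η / 416))
    with hcdef
  have hc1 : c ≤ 1 / (14 * E₁) := (min_le_left _ _).trans (min_le_left _ _)
  have hc2 : c ≤ 4 / (105 * E₂) := (min_le_left _ _).trans (min_le_right _ _)
  have hc3 : c ≤ 33 / (754 * E₃) := (min_le_right _ _).trans (min_le_left _ _)
  have hc4 : c ≤ 3 * η / 416 := (min_le_right _ _).trans (min_le_right _ _)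
  have hcpos : 0 < c := lt_min (lt_min (by positivity) (by positivity))
    (lt_min (by positivity) (by positivity))
  refine ⟨c, hcpos, fun pole Q Λ₀ Λ₁ Λ₂ F h ρ hzero hregion ↦ ?_⟩
  rw [hE₁, hEdef] at hc1
  rw [hE₂, hEdef] at hc2
  rw [hE₃, hEdef] at hc3
  exact h.zeroFree_of_le hcpos hc1 hc2 hc3 hc4 hzero hregion

/-- **The uniform datum generalises the datum of `TwistedZeroFreeRegion.lean`**: every
`TwistedZFRData η A C_g c₁ K₀ C₂ pole Q Λ₀ Λ₁ Λ₂ F` is a `UniformTwistedZFRData` with the same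
parameters (`K₀ ≤ K₀(log Q + log 4)` and `c₁(σ − 1) = c₁η/32` at `σ = 1 + η/32`), so that the
theorems of this file contain those of the former. [folklore] -/
theorem of_twistedZFRData (h : TwistedZFRData η A Cg c₁ K₀ C₂ pole Q Λ₀ Λ₁ Λ₂ F) :
    UniformTwistedZFRData η A Cg c₁ K₀ C₂ pole Q Λ₀ Λ₁ Λ₂ F where
  eta_pos := h.eta_pos
  eta_le_one := h.eta_le_one
  A_nonneg := h.A_nonneg
  Cg_pos := h.Cg_pos
  c₁_pos := h.c₁_pos
  K₀_nonneg := h.K₀_nonneg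
  C₂_nonneg := h.C₂_nonneg
  one_le_Q := h.one_le_Q
  nonneg := h.nonneg
  summable := h.summable
  re_LSeries₀_le σ hσ hσ2 := by
    have h1 := h.re_LSeries₀_le σ hσ hσ2
    have h2 : K₀ * 1 ≤ K₀ * (Real.log Q + Real.log 4) :=
      mul_le_mul_of_nonneg_left (log_add_log_four_ge h.one_le_Q) h.K₀_nonneg
    linarith
  norm_le₁ := h.norm_le₁
  norm_le₂ := h.norm_le₂
  three_four_one := h.three_four_one
  differentiableOn := h.differentiableOn
  ne_zero := h.ne_zero
  logDeriv_eq := h.logDeriv_eq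
  growth := h.growth
  lower t := by
    have hη := h.eta_pos
    have hη1 := h.eta_le_one
    have hre : (1 + η / 32 + t * I : ℂ).re = 1 + η / 32 := by simp
    have h1 := h.lower (1 + η / 32 + t * I) (by rw [hre]; linarith) (by rw [hre]; linarith)
    rw [hre, show 1 + η / 32 - 1 = η / 32 by ring] at h1
    exact h1
  re_LSeries₂_le := h.re_LSeries₂_le
  reflect := h.reflect

end UniformTwistedZFRData

end Literature.NumberTheory.LFunctions
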